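import Summits.QuantumFields.YangMills.Theorems.ParabolicTrajectoryContinuumLimitOnTrajectoryReductionPVG

/-!
# Route `ParabolicTrajectory`, crux `ContinuumLimitOnTrajectory` (stmt-QuantumFields-10522): vocabulary of line `two-orbit-synchronisation`, part G (seat c5) — the repaired route, pre-certified

Seventh route-posited vocabulary file of the line (lead `prover-line-stmt-QuantumFields-10522-c5-0`, seat c5; same
namespace as `…Defs` … `…DefsF`). The standing verdict on the crux AS TYPED (seats c2–c5) is *misstated*: its hypothesis
block bounds the torus half-side only by `a_k L_k → ∞`, and along slow-volume admissible schemes the torus seam of the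
smearing box defeats the conclusion kinematically (SEAM note; Negative/…FalseOfKernelScaleBlowUp). The repair is ONE clause,
polynomial volume growth, typed in `…DefsF` as `ContinuumLimitOnTrajectoryPVG` ((A) verbatim + the literal body of
`PolyVolumeGrowth sch` after `HasLatticeMassGap r sch Δ`) and closed modulo the chart and the two physics inputs by
`…ReductionPVG.continuumLimitOnTrajectoryPVG_of_inputs`. The route's deciding theorem `closes : (A) → (B) → (S) → YangMills`
then needs the clause from the CONSTRUCTOR of tuned sequences, i.e. (S) must carry it in its conclusion. This file
pre-certifies that repaired route so that the planner's restatement (rev 8) is copy-paste with a kernel-checked deciding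
theorem; NOTHING in §1 is asserted:
* §1 `TunedSequenceExistsPVG` — (S) `TunedSequenceExists` VERBATIM with ONE extra conjunct appended to its conclusion, the
  literal body of `PolyVolumeGrowth sch` (the constructor chooses the volumes; any of `a_k⁻¹ ≤ a_k L_k`, `M^(2 n_k) ≤ L_k`,
  `a_k^{-δ} ≤ a_k L_k` gives it: `…VolumeGlue`);
* §1 `AssemblyPVG` — the repaired assembly statement `(A_PVG) → (B) → (S_PVG) → YangMills`;
* §2 glue (proved): `tunedSequenceExists_of_PVG` ((S_PVG) ⇒ (S)); **`closesPVG : AssemblyPVG`** — the repaired route's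
  deciding theorem (the rev-7 `closes` rethreaded with one extra argument; pure logic); `closesWithGapPVG` (same from the
  line's Cauchy–Schwarz-currency statement `ContinuumLimitWithGapPVG`); **`yangMills_of_inputsPVG : ChartExists →
  IRPhysicsCS → UVPhysics345 → LatticeGapOnTrajectory → TunedSequenceExistsPVG → YangMills`** — after the restatement the
  whole route is closed modulo the two-orbit chart, the two physics inputs, crux (B) and the repaired (S).
Refs: `…DefsF`; `…ReductionPVG`; route file `Theses/ParabolicTrajectory.lean` rev 7 (`closes`); JaffeWitten2000 §6.
-/

set_option autoImplicit false

open scoped SchwartzMap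
open MeasureTheory Filter Topology
open Literature.MathematicalPhysics.QuantumFieldTheory Literature.MathematicalPhysics.QuantumLattice
open Literature.MathematicalPhysics.AQFT Literature.Probability.LatticeModels
open Summit.QuantumFields.YangMills.Theses.ParabolicTrajectory

noncomputable section

namespace Summit.QuantumFields.YangMills.Cruxes.ContinuumLimitOnTrajectory.TwoOrbitSynchronisation

/-! ## §1 The repaired (S) and the repaired assembly (line-posited; NOT asserted) -/

/-- **(S_PVG) — crux (S) `TunedSequenceExists` restated with the volume-growth clause in its CONCLUSION.** Verbatim the
rev-4 body of `Summit.QuantumFields.YangMills.Theses.ParabolicTrajectory.TunedSequenceExists` with ONE extra conjunct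
appended: the tuned `M`-adic Wilson scheme with `β_k → ∞` and convergent towers can be chosen with polynomial volume
growth, `∃ N ≥ 1, ∀ᶠ k, (a_k)⁻¹ ≤ (a_k L_k)^N` (the literal body of `PolyVolumeGrowth sch`). The recommended companion
restatement of stmt-QuantumFields-10524 when stmt-QuantumFields-10522 is restated as `ContinuumLimitOnTrajectoryPVG`
(the constructor of tuned sequences picks the volumes, so the clause costs (S) nothing); a strengthening of (S)
(`tunedSequenceExists_of_PVG`). -/
def TunedSequenceExistsPVG : Prop :=
  ∀ (G : Type) [Group G] [TopologicalSpace G] [IsTopologicalGroup G] [CompactSpace G], IsCompactSimpleLieGroup G →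
    letI : MeasurableSpace G := borel G
    haveI : BorelSpace G := ⟨rfl⟩
    ∀ (r : LatticeRep G) (M : ℕ), 2 ≤ M → ∃ θ₀ : ℝ, 0 < θ₀ ∧ ∀ θ : ℝ, 0 < θ → θ < θ₀ →
      ∃ (sch : SpeciesScheme (YMSpecies G)) (n : ℕ → ℕ), (∀ k, sch.a k = ((M : ℝ) ^ n k)⁻¹) ∧
        Tendsto sch.β atTop atTop ∧
        (∀ t : ℕ, 0 < t → ∃ c : ℝ, Tendsto (fun k => ((M : ℝ) ^ n k) ^ 8 *
          latticeConnectedCorr r.ρ (sch.β k) (sch.side k) r.curvature.F r.curvature.F (t * M ^ n k)) atTop (𝓝 c)) ∧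
        Tendsto (fun k => ((M : ℝ) ^ n k) ^ 8 *
          latticeConnectedCorr r.ρ (sch.β k) (sch.side k) r.curvature.F r.curvature.F (M ^ n k)) atTop (𝓝 θ) ∧
        (∃ N : ℕ, 1 ≤ N ∧ ∀ᶠ k in atTop, (sch.a k)⁻¹ ≤ (sch.a k * (sch.L k : ℝ)) ^ N)

/-- **The repaired assembly statement**: the restated (A) and (S) together with (B) as typed imply the sub-problem
statement `YangMills` — the shape of the route's deciding theorem after the restatement. -/
def AssemblyPVG : Prop :=
  ContinuumLimitOnTrajectoryPVG → LatticeGapOnTrajectory → TunedSequenceExistsPVG → YangMills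

/-! ## §2 Glue (proved) -/

/-- **The repaired (S) is a strengthening of (S)** (drop the volume conjunct). -/
theorem tunedSequenceExists_of_PVG : TunedSequenceExistsPVG → TunedSequenceExists := by
  intro h G _ _ _ _ hG
  letI : MeasurableSpace G := borel G
  haveI : BorelSpace G := ⟨rfl⟩
  intro r M hM
  obtain ⟨θ₀, hθ₀, hall⟩ := h G hG r M hM
  refine ⟨θ₀, hθ₀, fun θ hθ hθθ => ?_⟩
  obtain ⟨sch, n, hshape, hbeta, hconv, htune, -⟩ := hall θ hθ hθθ
  exact ⟨sch, n, hshape, hbeta, hconv, htune⟩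

/-- **The repaired route's deciding theorem** `(A_PVG) → (B) → (S_PVG) → YangMills`: the rev-7 `closes` rethreaded with
the volume-growth clause passed from the conclusion of (S_PVG) to the extra hypothesis of (A_PVG). Fix `G`;
`IsCompactSimpleLieGroup G` gives a lattice representation `r`; take `M = max M₀ 2` from (A_PVG), `θ₀ = min` of the
windows of (A_PVG) and (S_PVG), `θ = θ₀/2`; (S_PVG) gives a tuned scheme `sch` with `β_k → ∞` AND polynomial volume
growth; (B) gives `Δ > 0`, `HasLatticeMassGap r sch Δ` and the gap-transfer clause; (A_PVG) gives `sch'` (same `a, β, L`)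
and `T`; the transfer clause gives `T.HasMassGap Δ`; `HasLatticeMassGap r sch' Δ` is the lattice gap rewritten along
`sch'.(a, β, L) = sch.(a, β, L)`; the weak-coupling conjunct is `β_k → ∞` transported along `sch'.β = sch.β`. -/
theorem closesPVG : AssemblyPVG := by
  intro hA hB hS G _ _ _ _ hG
  obtain ⟨r⟩ := hG.2
  letI : MeasurableSpace G := borel G
  haveI : BorelSpace G := ⟨rfl⟩
  obtain ⟨M₀, hM₀⟩ := hA G hG r
  have hM2 : 2 ≤ max M₀ 2 := le_max_right _ _
  obtain ⟨θ₀, hθ₀, hA'⟩ := hM₀ (max M₀ 2) (le_max_left _ _) hM2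
  obtain ⟨θ₁, hθ₁, hS'⟩ := hS G hG r (max M₀ 2) hM2
  have hθpos : 0 < min θ₀ θ₁ / 2 := by positivity
  have hθlt₀ : min θ₀ θ₁ / 2 < θ₀ := by have := min_le_left θ₀ θ₁; linarith
  have hθlt₁ : min θ₀ θ₁ / 2 < θ₁ := by have := min_le_right θ₀ θ₁; linarith
  obtain ⟨sch, n, hshape, hbeta, hconv, htune, hgrowth⟩ := hS' (min θ₀ θ₁ / 2) hθpos hθlt₁
  obtain ⟨Δ, hΔ, hgap, htransfer⟩ :=
    hB G hG r (max M₀ 2) (min θ₀ θ₁ / 2) sch n hM2 hθpos hshape hbeta htune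
  obtain ⟨sch', ha, hβ, hL, T, hYM, hNT, hNG⟩ :=
    hA' (min θ₀ θ₁ / 2) Δ sch n hθpos hθlt₀ hΔ hshape hbeta hconv htune hgap hgrowth
  have hweak : sch'.HasWeakCouplingLimit := by
    show Tendsto sch'.β atTop atTop
    rw [hβ]
    exact hbeta
  refine ⟨r, sch', T, hweak, hYM, hNT, hNG, Δ, hΔ, htransfer sch' ha hβ hL T hYM, ?_⟩
  intro A B
  obtain ⟨C, hC⟩ := hgap A B
  refine ⟨C, ?_⟩
  simpa only [ha, hβ, hL] using hC

/-- The repaired deciding theorem in implication form (the literal rev-8 `closes`). -/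
theorem yangMills_of_PVG :
    ContinuumLimitOnTrajectoryPVG → LatticeGapOnTrajectory → TunedSequenceExistsPVG → YangMills :=
  closesPVG

/-- **The same from the line's Cauchy–Schwarz-currency statement** `ContinuumLimitWithGapPVG` ((A_PVG) with the continuum
gap clause of the witness appended, `…DefsF`). -/
theorem closesWithGapPVG :
    ContinuumLimitWithGapPVG → LatticeGapOnTrajectory → TunedSequenceExistsPVG → YangMills :=
  fun hA => closesPVG (continuumLimitOnTrajectoryPVG_of_withGapPVG hA)

/-- **After the restatement the whole route is closed modulo the two-orbit chart, the two physics inputs, crux (B) and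
the repaired (S)**: `…ReductionPVG.continuumLimitOnTrajectoryPVG_of_inputs` composed with `closesPVG`. -/
theorem yangMills_of_inputsPVG :
    ChartExists → IRPhysicsCS → UVPhysics345 → LatticeGapOnTrajectory → TunedSequenceExistsPVG → YangMills :=
  fun hchart hir huv => closesPVG (continuumLimitOnTrajectoryPVG_of_inputs hchart hir huv)

/-- **Consistency with the route as typed**: the rev-7 assembly `(A) → (B) → (S) → YangMills` also follows from the
repaired one whenever (S) is upgraded to (S_PVG) — (A) as typed implies (A_PVG) (`continuumLimitOnTrajectoryPVG_of_crux`).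
So restating costs the route nothing it had. -/
theorem yangMills_of_crux_of_PVG :
    ContinuumLimitOnTrajectory → LatticeGapOnTrajectory → TunedSequenceExistsPVG → YangMills :=
  fun hA => closesPVG (continuumLimitOnTrajectoryPVG_of_crux hA)

end Summit.QuantumFields.YangMills.Cruxes.ContinuumLimitOnTrajectory.TwoOrbitSynchronisation

end
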